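import Summits.Ventures.PercRepro.RankLevelSet
import Summits.Ventures.PercRepro.RankLevelSetAC
import Summits.Ventures.PercRepro.RankLevelSetBAll
import Summits.Ventures.PercRepro.TheoremNAll

/-!
# PercRepro — C-025 holds for `q ≤ 2` (the Conjectures-file bridge; typer-2, gen 6)

The row `C025` (`RankLevelSet.lean`) restricted to `q ≤ Q` is **`C025UpTo Q`**; **`C025UpTo_two`** assembles the
three proved cases — `q = 0` (p3 `c025_of_q_zero`, Theorem A), `q = 1` (p3 `c025_of_q_one`, Theorem B on every
finite matroid) and `q = 2` (p2 `c025_of_q_two`, mine-2's Theorem N on every finite matroid) — into one statement: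
for every finite matroid `M`, every `q ≤ 2` and every `p ≥ q + 2`,
`Φ(p, q) · #{A ⊆ E : ρ(A) = p, ρ(E ∖ A) = q} ≤ #{A ⊆ E : q < ρ(A) < p}`.
-/

namespace PercRepro

/-- **C-025 restricted to `q ≤ Q`**: the row `C025` with the extra hypothesis `q ≤ Q`. -/
def C025UpTo (Q : ℕ) : Prop :=
  ∀ {α : Type} (M : Matroid α) [M.Finite] (p q : ℕ), q ≤ Q → q + 2 ≤ p →
    phiK p q * ({A : Set α | A ⊆ M.E ∧ M.eRk A = (p : ℕ∞) ∧ M.eRk (M.E \ A) = (q : ℕ∞)}.ncard : ℚ) ≤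
      ({A : Set α | A ⊆ M.E ∧ (q : ℕ∞) < M.eRk A ∧ M.eRk A < (p : ℕ∞)}.ncard : ℚ)

/-- The row `C025` implies each of its restrictions. -/
theorem C025UpTo_of_C025 (h : C025) (Q : ℕ) : C025UpTo Q :=
  fun M _ p q _ hpq => h M p q hpq

/-- **C-025 holds for `q ≤ 2`** — Theorem A (`q = 0`), Theorem B (`q = 1`) and Theorem N (`q = 2`), each on every
finite matroid and every `p ≥ q + 2`. -/
theorem C025UpTo_two : C025UpTo 2 := by
  intro α M _ p q hq hpq
  interval_cases q
  · exact c025_of_q_zero (M := M) p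
  · exact c025_of_q_one M p
  · exact c025_of_q_two M p hpq

end PercRepro
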